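import Literature.Geometry.Symplectic.NearSymplecticFlatBirthProofs
import HarnessLib

/-!
# Toward the flat birth pair, III: coefficient calculus for explicit pairs on `ℝ³`

Proofs companion of `NearSymplecticFlatBirth.lean` (named fact
`Literature.Geometry.Symplectic.flatNearSymplecticTaubesTubes_exists`), continuing
`NearSymplecticFlatBirthProofs.lean`: groundwork for instantiating the landed reduction
`flatNearSymplecticTaubesTubes_exists_of_calabiPair` with an EXPLICIT pair `(g, λ)` (everything
here is PROVED; no facts):

* `covOfCoeffs a b c` — the `1`-form `a dq₀ + b dq₁ + c dq₂` from three coefficient functions, its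
  smoothness and derivative;
* `density3_covOfCoeffs` — the density of the pair `(g, a dq₀ + b dq₁ + c dq₂)` is
  `curl(a, b, c) · ∇g` written in partial derivatives `∂ᵢh = dh(eᵢ)`;
* partial-derivative bookkeeping for functions of the height `q₀` and of `ρ² = q₁² + q₂²`
  (the two kinds of profile the design uses);
* the PAIR SCHEMA of the intended construction (`schemaG`, `schemaLam`: a `1`-dimensional seed
  `F(x) + y² − z²` carrying both Honda germs, localised by radial profiles, with the transversal
  `2`-form written through its explicit primitive) and its density in closed form
  (`density3_schema`, `schemaDensity_core`, `schemaDensity_germ_upper/lower`, `schemaDensity_far`).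

## References

* T. Perutz, *Zero-sets of near-symplectic forms*, J. Symplectic Geom. 4 (2006), Prop. 1.5,
  Rem. 1.9 [Perutz2006].
* E. Calabi, *An intrinsic characterization of harmonic one-forms*, Global Analysis (1969),
  §VI (the example `x(r² − 1) + y² − z²`) [Calabi1969HarmonicOneForms].
-/

noncomputable section

open scoped ContDiff Topology
open Set Filter ContinuousAlternatingMap

namespace Literature.Geometry.Symplectic

local notation "E3" => EuclideanSpace ℝ (Fin 3)

section Coeffs

/-- The coordinate covectors `dqᵢ` on `ℝ³`. [folklore] -/
abbrev dq (i : Fin 3) : E3 →L[ℝ] ℝ := EuclideanSpace.proj i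

/-- `dqᵢ(v) = vᵢ`. [folklore] -/
@[simp] theorem dq_apply (i : Fin 3) (v : E3) : dq i v = v i := rfl

/-- `dqᵢ(eⱼ) = δᵢⱼ`. [folklore] -/
@[simp] theorem dq_stdVec3 (i j : Fin 3) : dq i (stdVec3 j) = if i = j then 1 else 0 := by
  rw [dq_apply, stdVec3_apply]

/-- **The `1`-form `a dq₀ + b dq₁ + c dq₂`** with coefficient functions `a, b, c : ℝ³ → ℝ`.
[folklore] -/
def covOfCoeffs (a b c : E3 → ℝ) (q : E3) : E3 →L[ℝ] ℝ :=
  a q • dq 0 + b q • dq 1 + c q • dq 2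

/-- Values of `a dq₀ + b dq₁ + c dq₂`. [folklore] -/
@[simp] theorem covOfCoeffs_apply (a b c : E3 → ℝ) (q v : E3) :
    covOfCoeffs a b c q v = a q * v 0 + b q * v 1 + c q * v 2 := by
  simp [covOfCoeffs]

/-- Smoothness of `a dq₀ + b dq₁ + c dq₂` from that of the coefficients. [folklore] -/
theorem contDiff_covOfCoeffs {a b c : E3 → ℝ} (ha : ContDiff ℝ ∞ a) (hb : ContDiff ℝ ∞ b)
    (hc : ContDiff ℝ ∞ c) : ContDiff ℝ ∞ (covOfCoeffs a b c) := by
  unfold covOfCoeffs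
  exact ((ha.smul contDiff_const).add (hb.smul contDiff_const)).add (hc.smul contDiff_const)

/-- **The derivative of `a dq₀ + b dq₁ + c dq₂`**: `v ↦ da(v) dq₀ + db(v) dq₁ + dc(v) dq₂`.
[folklore] -/
theorem hasFDerivAt_covOfCoeffs {a b c : E3 → ℝ} {q : E3} {a' b' c' : E3 →L[ℝ] ℝ}
    (ha : HasFDerivAt a a' q) (hb : HasFDerivAt b b' q) (hc : HasFDerivAt c c' q) :
    HasFDerivAt (covOfCoeffs a b c)
      (a'.smulRight (dq 0) + b'.smulRight (dq 1) + c'.smulRight (dq 2)) q := by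
  unfold covOfCoeffs
  exact ((ha.smul_const (dq 0)).add (hb.smul_const (dq 1))).add (hc.smul_const (dq 2))

/-- `dλ(u, v)` for `λ = a dq₀ + b dq₁ + c dq₂` in terms of the derivatives of the coefficients.
[folklore] -/
theorem fderiv_covOfCoeffs_apply_sub {a b c : E3 → ℝ} {q : E3} (ha : DifferentiableAt ℝ a q)
    (hb : DifferentiableAt ℝ b q) (hc : DifferentiableAt ℝ c q) (u v : E3) :
    fderiv ℝ (covOfCoeffs a b c) q u v - fderiv ℝ (covOfCoeffs a b c) q v u =
      (fderiv ℝ a q u * v 0 - fderiv ℝ a q v * u 0) +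
        (fderiv ℝ b q u * v 1 - fderiv ℝ b q v * u 1) +
        (fderiv ℝ c q u * v 2 - fderiv ℝ c q v * u 2) := by
  rw [(hasFDerivAt_covOfCoeffs ha.hasFDerivAt hb.hasFDerivAt hc.hasFDerivAt).fderiv]
  simp only [_root_.add_apply, ContinuousLinearMap.smulRight_apply, _root_.smul_apply, smul_eq_mul,
    dq_apply]
  ring

/-- **The density of an explicit pair is `curl · ∇`**: for `λ = a dq₀ + b dq₁ + c dq₂` and a
function `g`, with `∂ᵢh := dh_q(eᵢ)`,
`D = (∂₀b − ∂₁a) ∂₂g − (∂₀c − ∂₂a) ∂₁g + (∂₁c − ∂₂b) ∂₀g`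
(`= W · ∇g` for `W = curl(a, b, c) = (∂₁c − ∂₂b, ∂₂a − ∂₀c, ∂₀b − ∂₁a)`, `dλ = ι_W dvol`).
[folklore] -/
theorem density3_covOfCoeffs {a b c : E3 → ℝ} (g : E3 → ℝ) {q : E3}
    (ha : DifferentiableAt ℝ a q) (hb : DifferentiableAt ℝ b q) (hc : DifferentiableAt ℝ c q) :
    density3 g (covOfCoeffs a b c) q =
      (fderiv ℝ b q (stdVec3 0) - fderiv ℝ a q (stdVec3 1)) * fderiv ℝ g q (stdVec3 2) -
        (fderiv ℝ c q (stdVec3 0) - fderiv ℝ a q (stdVec3 2)) * fderiv ℝ g q (stdVec3 1) +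
        (fderiv ℝ c q (stdVec3 1) - fderiv ℝ b q (stdVec3 2)) * fderiv ℝ g q (stdVec3 0) := by
  simp only [density3, fderiv_covOfCoeffs_apply_sub ha hb hc, stdVec3_apply]
  simp only [Fin.isValue, Fin.reduceEq, if_true, if_false, mul_one, mul_zero, sub_zero, zero_sub,
    add_zero, zero_add]
  ring

end Coeffs

/-! ### Profiles of the height `q₀` and of `ρ² = q₁² + q₂²` -/

section Profiles

/-- `ρ²(q) = q₁² + q₂²`, the squared distance from the vertical axis of `ℝ³`. [folklore] -/
def rhoSq (q : E3) : ℝ := q 1 ^ 2 + q 2 ^ 2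

/-- `ρ² ≥ 0`. [folklore] -/
theorem rhoSq_nonneg (q : E3) : 0 ≤ rhoSq q := by unfold rhoSq; positivity

/-- `ρ²` is `C^∞`. [folklore] -/
theorem contDiff_rhoSq : ContDiff ℝ ∞ rhoSq := by unfold rhoSq; fun_prop

/-- The derivative of `ρ²`: `d(ρ²)(v) = 2q₁v₁ + 2q₂v₂`. [folklore] -/
theorem hasFDerivAt_rhoSq (q : E3) :
    HasFDerivAt rhoSq ((2 * q 1) • dq 1 + (2 * q 2) • dq 2) q := by
  have hc : ∀ i : Fin 3, HasFDerivAt (fun x : E3 => x i)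
      (PiLp.proj 2 (𝕜 := ℝ) (fun _ : Fin 3 => ℝ) i) q := fun i =>
    PiLp.hasFDerivAt_apply (𝕜 := ℝ) 2 q i
  have h := ((hc 1).pow 2).add ((hc 2).pow 2)
  have h' : HasFDerivAt rhoSq _ q :=
    h.congr_of_eventuallyEq (Eventually.of_forall fun x => by simp [rhoSq])
  refine h'.congr_fderiv ?_
  ext v
  simp only [_root_.add_apply, _root_.smul_apply, PiLp.proj_apply, smul_eq_mul, nsmul_eq_mul,
    Nat.cast_ofNat]
  ring

/-- Partial derivatives of `ρ²` on the standard basis: `(0, 2q₁, 2q₂)`. [folklore] -/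
theorem fderiv_rhoSq_stdVec3 (q : E3) (i : Fin 3) :
    fderiv ℝ rhoSq q (stdVec3 i) = if i = 0 then 0 else 2 * q i := by
  rw [(hasFDerivAt_rhoSq q).fderiv]
  fin_cases i <;> simp

/-- **A radial profile `q ↦ h(ρ²)`** is `C^∞` for `C^∞` `h`. [folklore] -/
theorem contDiff_comp_rhoSq {h : ℝ → ℝ} (hh : ContDiff ℝ ∞ h) :
    ContDiff ℝ ∞ (fun q : E3 => h (rhoSq q)) :=
  hh.comp contDiff_rhoSq

/-- **Partial derivatives of a radial profile**: `∂ᵢ(h∘ρ²) = h'(ρ²)·(0, 2q₁, 2q₂)ᵢ`. [folklore] -/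
theorem fderiv_comp_rhoSq_stdVec3 {h : ℝ → ℝ} {q : E3} (hh : DifferentiableAt ℝ h (rhoSq q))
    (i : Fin 3) :
    fderiv ℝ (fun x : E3 => h (rhoSq x)) q (stdVec3 i) =
      if i = 0 then 0 else deriv h (rhoSq q) * (2 * q i) := by
  have hcomp : HasFDerivAt (fun x : E3 => h (rhoSq x))
      ((deriv h (rhoSq q)) • ((2 * q 1) • dq 1 + (2 * q 2) • dq 2)) q := by
    exact hh.hasDerivAt.comp_hasFDerivAt q (hasFDerivAt_rhoSq q)
  rw [hcomp.fderiv]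
  fin_cases i <;> simp

/-- **A vertical profile `q ↦ φ(q₀)`** is `C^∞` for `C^∞` `φ`. [folklore] -/
theorem contDiff_comp_height {φ : ℝ → ℝ} (hφ : ContDiff ℝ ∞ φ) :
    ContDiff ℝ ∞ (fun q : E3 => φ (q 0)) :=
  hφ.comp (by fun_prop)

/-- **Partial derivatives of a vertical profile**: `∂ᵢ(φ∘q₀) = (φ'(q₀), 0, 0)ᵢ`. [folklore] -/
theorem fderiv_comp_height_stdVec3 {φ : ℝ → ℝ} {q : E3} (hφ : DifferentiableAt ℝ φ (q 0))
    (i : Fin 3) :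
    fderiv ℝ (fun x : E3 => φ (x 0)) q (stdVec3 i) = if i = 0 then deriv φ (q 0) else 0 := by
  have h0 : HasFDerivAt (fun x : E3 => x 0) (dq 0) q := PiLp.hasFDerivAt_apply (𝕜 := ℝ) 2 q 0
  have hcomp : HasFDerivAt (fun x : E3 => φ (x 0)) ((deriv φ (q 0)) • dq 0) q := by
    exact hφ.hasDerivAt.comp_hasFDerivAt q h0
  rw [hcomp.fderiv]
  fin_cases i <;> simp

/-- Partial derivatives of the coordinate functions: `∂ᵢqⱼ = δᵢⱼ`. [folklore] -/
theorem fderiv_coord_stdVec3 (q : E3) (i j : Fin 3) :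
    fderiv ℝ (fun x : E3 => x j) q (stdVec3 i) = if i = j then 1 else 0 := by
  have h : HasFDerivAt (fun x : E3 => x j) (dq j) q := PiLp.hasFDerivAt_apply (𝕜 := ℝ) 2 q j
  rw [h.fderiv, dq_stdVec3]
  rcases eq_or_ne i j with rfl | hij
  · simp
  · simp [hij, hij.symm]

end Profiles

/-! ### The pair schema of the design and its density

The design (seat notes §F) is the pair
`g = q₀ + σ(q₀) k(ρ²) (q₁² − q₂²) + ω(q₀) χ(ρ²)`,
`λ = ½(q₁dq₂ − q₂dq₁) + β(q₀) S(ρ²) q₁q₂ dq₀ + ω'(q₀) H(ρ²) (q₁dq₂ − q₂dq₁)`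
for `C^∞` profiles `ω, σ, β` of the height and `k, χ, S, H` of `ρ²`.  Here we define it and
compute its density `D = W·∇g` in closed form (`schemaDensity`), once and for all. -/

section Schema

variable (w sg bt kk cf SS HH : ℝ → ℝ)

/-- **The function of the design**: `g = q₀ + sg(q₀)kk(ρ²)(q₁² − q₂²) + w(q₀)cf(ρ²)`. [folklore] -/
def schemaG (q : E3) : ℝ :=
  q 0 + sg (q 0) * kk (rhoSq q) * (q 1 ^ 2 - q 2 ^ 2) + w (q 0) * cf (rhoSq q)

/-- Coefficient of `dq₀` in the design's `1`-form: `bt(q₀)SS(ρ²)q₁q₂`. [folklore] -/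
def schemaA (q : E3) : ℝ := bt (q 0) * SS (rhoSq q) * q 1 * q 2

/-- Coefficient of `dq₁`: `−q₂/2 − w'(q₀)HH(ρ²)q₂`. [folklore] -/
def schemaB (q : E3) : ℝ := -(1 / 2) * q 2 - deriv w (q 0) * HH (rhoSq q) * q 2

/-- Coefficient of `dq₂`: `q₁/2 + w'(q₀)HH(ρ²)q₁`. [folklore] -/
def schemaC (q : E3) : ℝ := (1 / 2) * q 1 + deriv w (q 0) * HH (rhoSq q) * q 1

/-- **The `1`-form of the design**
`λ = ½(q₁dq₂ − q₂dq₁) + bt(q₀)SS(ρ²)q₁q₂ dq₀ + w'(q₀)HH(ρ²)(q₁dq₂ − q₂dq₁)`. [folklore] -/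
def schemaLam : E3 → E3 →L[ℝ] ℝ :=
  covOfCoeffs (schemaA bt SS) (schemaB w HH) (schemaC w HH)

/-- **The density of the design in closed form**, as a function of the profile values and
derivatives `w0 = w(x), w1 = w'(x), w2 = w''(x), s0, s1, b0` at the height `x = q₀` and
`k0, k1, c0, c1, S0, S1, H0, H1` at `r = ρ²`, and of `y = q₁, z = q₂`:
`D = Wₓgₓ + W_yg_y + W_zg_z` with
`Wₓ = 1 + w1(2H0 + 2rH1)`, `W_y = b0(S0 + 2z²S1)y − w2H0y`, `W_z = −b0(S0 + 2y²S1)z − w2H0z`,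
`gₓ = 1 + s1k0(y² − z²) + w1c0`, `g_y = 2s0y(k0 + k1(y² − z²)) + 2w0c1y`,
`g_z = 2s0z(−k0 + k1(y² − z²)) + 2w0c1z`. [folklore] -/
def schemaDensity (w0 w1 w2 s0 s1 b0 k0 k1 c0 c1 S0 S1 H0 H1 y z : ℝ) : ℝ :=
  (1 + w1 * (2 * H0 + 2 * (y ^ 2 + z ^ 2) * H1)) * (1 + s1 * k0 * (y ^ 2 - z ^ 2) + w1 * c0) +
    (b0 * (S0 + 2 * z ^ 2 * S1) * y - w2 * H0 * y) *
      (2 * s0 * y * (k0 + k1 * (y ^ 2 - z ^ 2)) + 2 * w0 * c1 * y) +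
    (-(b0 * (S0 + 2 * y ^ 2 * S1) * z) - w2 * H0 * z) *
      (2 * s0 * z * (-k0 + k1 * (y ^ 2 - z ^ 2)) + 2 * w0 * c1 * z)

variable {w sg bt kk cf SS HH}

/-- The derivative of a height profile as a covector. [folklore] -/
theorem hasFDerivAt_comp_height {φ : ℝ → ℝ} {q : E3} (hφ : DifferentiableAt ℝ φ (q 0)) :
    HasFDerivAt (fun x : E3 => φ (x 0)) (deriv φ (q 0) • dq 0) q :=
  hφ.hasDerivAt.comp_hasFDerivAt q (PiLp.hasFDerivAt_apply (𝕜 := ℝ) 2 q 0)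

/-- The derivative of a radial profile as a covector. [folklore] -/
theorem hasFDerivAt_comp_rhoSq {h : ℝ → ℝ} {q : E3} (hh : DifferentiableAt ℝ h (rhoSq q)) :
    HasFDerivAt (fun x : E3 => h (rhoSq x))
      (deriv h (rhoSq q) • ((2 * q 1) • dq 1 + (2 * q 2) • dq 2)) q :=
  hh.hasDerivAt.comp_hasFDerivAt q (hasFDerivAt_rhoSq q)

/-- The coordinate functions as differentiable maps with derivative `dqᵢ`. [folklore] -/
theorem hasFDerivAt_coord (q : E3) (i : Fin 3) : HasFDerivAt (fun x : E3 => x i) (dq i) q :=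
  PiLp.hasFDerivAt_apply (𝕜 := ℝ) 2 q i

/-- **`g` of the design is `C^∞`** for `C^∞` profiles. [folklore] -/
theorem contDiff_schemaG (hω : ContDiff ℝ ∞ w) (hσ : ContDiff ℝ ∞ sg) (hk : ContDiff ℝ ∞ kk)
    (hχ : ContDiff ℝ ∞ cf) : ContDiff ℝ ∞ (schemaG w sg kk cf) := by
  unfold schemaG
  have h0 : ContDiff ℝ ∞ (fun q : E3 => q 0) := by fun_prop
  have h1 : ContDiff ℝ ∞ (fun q : E3 => q 1) := by fun_prop
  have h2 : ContDiff ℝ ∞ (fun q : E3 => q 2) := by fun_prop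
  exact (h0.add (((contDiff_comp_height hσ).mul (contDiff_comp_rhoSq hk)).mul
    ((h1.pow 2).sub (h2.pow 2)))).add ((contDiff_comp_height hω).mul (contDiff_comp_rhoSq hχ))

/-- **`λ` of the design is `C^∞`** for `C^∞` profiles. [folklore] -/
theorem contDiff_schemaLam (hω : ContDiff ℝ ∞ w) (hβ : ContDiff ℝ ∞ bt) (hS : ContDiff ℝ ∞ SS)
    (hH : ContDiff ℝ ∞ HH) : ContDiff ℝ ∞ (schemaLam w bt SS HH) := by
  have h1 : ContDiff ℝ ∞ (fun q : E3 => q 1) := by fun_prop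
  have h2 : ContDiff ℝ ∞ (fun q : E3 => q 2) := by fun_prop
  have hω' : ContDiff ℝ ∞ (deriv w) := hω.iterate_deriv 1
  refine contDiff_covOfCoeffs ?_ ?_ ?_
  · unfold schemaA
    exact (((contDiff_comp_height hβ).mul (contDiff_comp_rhoSq hS)).mul h1).mul h2
  · unfold schemaB
    exact (contDiff_const.mul h2).sub (((contDiff_comp_height hω').mul (contDiff_comp_rhoSq hH)).mul h2)
  · unfold schemaC
    exact (contDiff_const.mul h1).add (((contDiff_comp_height hω').mul (contDiff_comp_rhoSq hH)).mul h1)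

/-- **The density of the design pair is `schemaDensity`** evaluated at the profile data at `q`.
[folklore] -/
theorem density3_schema {q : E3} (hω : ContDiff ℝ ∞ w) (hσ : Differentiable ℝ sg)
    (hβ : Differentiable ℝ bt) (hk : Differentiable ℝ kk) (hχ : Differentiable ℝ cf)
    (hS : Differentiable ℝ SS) (hH : Differentiable ℝ HH) :
    density3 (schemaG w sg kk cf) (schemaLam w bt SS HH) q =
      schemaDensity (w (q 0)) (deriv w (q 0)) (deriv (deriv w) (q 0)) (sg (q 0)) (deriv sg (q 0))
        (bt (q 0)) (kk (rhoSq q)) (deriv kk (rhoSq q)) (cf (rhoSq q)) (deriv cf (rhoSq q))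
        (SS (rhoSq q)) (deriv SS (rhoSq q)) (HH (rhoSq q)) (deriv HH (rhoSq q)) (q 1) (q 2) := by
  have hωd : Differentiable ℝ w := hω.differentiable (by simp)
  have hω'd : Differentiable ℝ (deriv w) := (hω.iterate_deriv 1).differentiable (by simp)
  -- the four derivatives, with Lean-computed covectors
  unfold schemaLam schemaA schemaB schemaC schemaG
  have hA := (((hasFDerivAt_comp_height (q := q) (hβ _)).fun_mul
    (hasFDerivAt_comp_rhoSq (q := q) (hS _))).fun_mul (hasFDerivAt_coord q 1)).fun_mul
    (hasFDerivAt_coord q 2)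
  have hB := ((hasFDerivAt_coord q 2).const_mul (-(1 / 2 : ℝ))).fun_sub
    (((hasFDerivAt_comp_height (q := q) (hω'd _)).fun_mul
      (hasFDerivAt_comp_rhoSq (q := q) (hH _))).fun_mul (hasFDerivAt_coord q 2))
  have hC := ((hasFDerivAt_coord q 1).const_mul (1 / 2 : ℝ)).fun_add
    (((hasFDerivAt_comp_height (q := q) (hω'd _)).fun_mul
      (hasFDerivAt_comp_rhoSq (q := q) (hH _))).fun_mul (hasFDerivAt_coord q 1))
  have hG := ((hasFDerivAt_coord q 0).fun_add
    (((hasFDerivAt_comp_height (q := q) (hσ _)).fun_mul (hasFDerivAt_comp_rhoSq (q := q) (hk _))).fun_mul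
      (((hasFDerivAt_coord q 1).pow 2).fun_sub ((hasFDerivAt_coord q 2).pow 2)))).fun_add
    ((hasFDerivAt_comp_height (q := q) (hωd _)).fun_mul (hasFDerivAt_comp_rhoSq (q := q) (hχ _)))
  rw [density3_covOfCoeffs _ hA.differentiableAt hB.differentiableAt hC.differentiableAt,
    hA.fderiv, hB.fderiv, hC.fderiv, hG.fderiv]
  simp only [_root_.add_apply, _root_.sub_apply, _root_.smul_apply, smul_eq_mul, dq_stdVec3,
    nsmul_eq_mul, Nat.cast_ofNat]
  simp only [Fin.isValue, Fin.reduceEq, if_true, if_false, mul_one, mul_zero, add_zero, zero_add,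
    sub_zero]
  unfold schemaDensity rhoSq
  ring

/-- **In the core the density is the seed's sum of squares**: where `sg = 1`, `sg' = 0`,
`kk = cf = SS = 1`, `HH = ½` with vanishing derivatives,
`D = (1 + w')² + 2(bt − w''/2)y² + 2(bt + w''/2)z²` (`= F'² + 4my² + 4nz²`). [folklore] -/
theorem schemaDensity_core (w0 w1 w2 b0 y z : ℝ) :
    schemaDensity w0 w1 w2 1 0 b0 1 0 1 0 1 0 (1 / 2) 0 y z =
      (1 + w1) ^ 2 + 2 * (b0 - w2 / 2) * y ^ 2 + 2 * (b0 + w2 / 2) * z ^ 2 := by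
  unfold schemaDensity
  ring

/-- **Honda's germ at the upper point**: with `w' = 2x' − 1` (`F' = 2x'`), `w'' = 2`, `bt = 3` the
core density is `4x'² + 4y² + 8z²`. [folklore] -/
theorem schemaDensity_germ_upper (w0 x' y z : ℝ) :
    schemaDensity w0 (2 * x' - 1) 2 1 0 3 1 0 1 0 1 0 (1 / 2) 0 y z =
      4 * x' ^ 2 + 4 * y ^ 2 + 8 * z ^ 2 := by
  unfold schemaDensity
  ring

/-- **Honda's germ at the lower point**: with `w' = −2x' − 1` (`F' = −2x'`), `w'' = −2`, `bt = 3`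
the core density is `4x'² + 8y² + 4z²`. [folklore] -/
theorem schemaDensity_germ_lower (w0 x' y z : ℝ) :
    schemaDensity w0 (-2 * x' - 1) (-2) 1 0 3 1 0 1 0 1 0 (1 / 2) 0 y z =
      4 * x' ^ 2 + 8 * y ^ 2 + 4 * z ^ 2 := by
  unfold schemaDensity
  ring

/-- **Far field**: where `w = w' = w'' = 0` and `bt = 0` the density is `gₓ = 1 + sg'k(y² − z²)`
(`W = eₓ`). [folklore] -/
theorem schemaDensity_far (s0 s1 k0 k1 c0 c1 S0 S1 H0 H1 y z : ℝ) :
    schemaDensity 0 0 0 s0 s1 0 k0 k1 c0 c1 S0 S1 H0 H1 y z = 1 + s1 * k0 * (y ^ 2 - z ^ 2) := by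
  unfold schemaDensity
  ring

end Schema

end Literature.Geometry.Symplectic

end
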